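import Summits.QuantumFields.YangMills.Theorems.BalabanUVNodesN21DilationHazard
import Summits.QuantumFields.YangMills.Theorems.BalabanUVNodesN21DilationRoadEnd

/-!
# N21 (NE7c) · the dilation device under RADIAL TRANSVERSALITY, with cuts riding in an ENVELOPE charged to odds
# (lens Card 69 ∕ ROW D — generalises part 16)

R134 seat pub-ymgap-dag-n21-d (g8), node N21 = NE7c (single-run shell-weight bound, NOT PRINTED in [Bałaban 1983–89],
NOT proved), lane K3⁷ `SpineGivenEndpointR13SepCoPH` (stmt-QuantumFields-20544, `--kind proof --supports … --as helper`).
Part 19 of the comparison series (§D = lens; §K concordance + §E END-with-constant = this seat, lens ROW G).  THIS FILE = LENS ROW D of `ym-lens-BalabanUVNodes-nearmiss/LENS-nearmiss.md` v24.0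
(Card 69, first refusal dag-n21-d as the author of part 16 `…N21DilationHazard`): the §D section of the lens's
`Sketch-nearmiss-g24.lean` (sha16 85981f4eed0c46af, farm rc 0 · 0 warnings at the lens desk) VERBATIM — statements and
proofs — re-homed in this namespace, WITH TWO SUBSTITUTIONS forced by the dedup rule: the sketch's restated
`setLIntegral_le_of_radialMono` and `shrinkJacobian_le_three` are DELETED and part 16's identical
`setLIntegral_le_pow_mul_setLIntegral_smul` ∕ `inv_pow_le_three` are CITED BY NAME in their place (as the sketch itself
asks).  AUTHORSHIP OF THE MATHEMATICS: planner seat `ym-lens-BalabanUVNodes-nearmiss` g24 (memo-only seat, cannot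
file); this seat only files.  §R + §X of the same sketch (the radial inputs about the background; large-field letters
under inward dilation) land separately as part 20 `…N21DilationRadialInputs` (400-line rule).

WHAT (lens Card 69, state W²²).  Part 16's two hypotheses want different centres at a live slot: radial monotonicity of
the action holds about the fibre's BACKGROUND `A₀` (constrained minimiser), exact 1-homogeneity of a cube statistic
about the identity, which is not in the fibre; about `A₀` a cube statistic is AFFINE-radial.  The repair: ONE centre
(the background), homogeneity replaced by RADIAL TRANSVERSALITY `U(s•z) ≥ U z + κa(s−1)` between shell points
(`volume_params_le_of_radialTransversal`: admissible parameters have diameter `≤ (b−a)∕(κa)`), an arbitrary measurable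
cut `C` on the shell and an ENVELOPE `Env ∋ l•z` of the inward dilates (`measure_shellCut_le_average_env`,
`measure_shellCut_le_of_radialTransversal`), the envelope's excess over the support charged to conditional large-field
ODDS `Q` (`measure_env_le_of_odds`), giving ★ `slotAntiConcentration_restrict_of_radialTransversal`:
`SlotAntiConcentration (ν|({U<θ} ∩ C)) U θ ρ (3(d+1)(1+Q)∕(κ(1−ρ)))` — part 16's
`slotAntiConcentration_restrict_of_homogeneous` is the instance `C = univ`, `Env = {U<θ}`, `κ = 1`, `Q = 0`;
`smul_mem_env_of_star`: star-shaped cuts ride along, dropped cuts leave the envelope.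

HONEST FRAMING.  [textbook] measure theory over the tree's typed (M1) frame (cited by name); every located input stays
a HYPOTHESIS; 0 def, 0 sorry; nothing of Bałaban's asserted; NE7c NOT PRINTED ∕ NOT proved; N21 NOT discharged;
counts unmoved (typed 28∕28 · discharged 5∕27); count-neutral; one finite 𝕋⁴ at fixed ε — nothing about ℝ⁴ ∕ OS ∕
mass gap ∕ Clay.
-/

open MeasureTheory Set Function Module
open scoped ENNReal NNReal Pointwise

namespace Summit.QuantumFields.YangMills.Theorems.N21DilationTransversal

open Literature.MathematicalPhysics.QuantumFieldTheory.Balaban1983to89.T4ShellMeasure (SlotAntiConcentration)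
open Summit.QuantumFields.YangMills.Theorems.N21DilationHazard
  (setLIntegral_le_pow_mul_setLIntegral_smul inv_pow_le_three)

variable {ι : Type*} [Fintype ι]

/-! ## §D Generalised dilation averaging (Card 69) -/

omit [Fintype ι] in
/-- **ADMISSIBLE DILATION PARAMETERS UNDER RADIAL TRANSVERSALITY.**  `T ⊆ {a ≤ U < b}`; radial transversality on
`T`: for `z ∈ T`, `s ≥ 1` with `s • z ∈ T`, `U(s•z) ≥ U z + κ a (s − 1)`.  Then for every `y` the set of
`l ∈ [1−τ, 1]` with `l⁻¹ • y ∈ T` has Lebesgue measure `≤ (b − a)/(κ a)` (it has diameter at most that).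
Exactly 1-homogeneous `U` is the case `κ = 1`; affine-radial `U = ‖c + F·‖` gives `κ = 1 − ‖c‖/a` (§R). [textbook] -/
theorem volume_params_le_of_radialTransversal {U : (ι → ℝ) → ℝ} {T : Set (ι → ℝ)} {a b κ τ : ℝ}
    (ha : 0 < a) (hκ : 0 < κ) (hτ : τ < 1)
    (hT : ∀ z ∈ T, a ≤ U z ∧ U z < b)
    (hRT : ∀ z ∈ T, ∀ s : ℝ, 1 ≤ s → s • z ∈ T → U z + κ * a * (s - 1) ≤ U (s • z))
    (y : ι → ℝ) :
    volume {l : ℝ | l ∈ Icc (1 - τ) 1 ∧ l⁻¹ • y ∈ T} ≤ ENNReal.ofReal ((b - a) / (κ * a)) := by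
  set W := {l : ℝ | l ∈ Icc (1 - τ) 1 ∧ l⁻¹ • y ∈ T} with hW
  have hκa : 0 < κ * a := mul_pos hκ ha
  have key : ∀ l₁ ∈ W, ∀ l₂ ∈ W, l₁ ≤ l₂ → l₂ - l₁ ≤ (b - a) / (κ * a) := by
    intro l₁ h₁ l₂ h₂ h12
    have hl₁ : 0 < l₁ := by linarith [h₁.1.1]
    have hl₂ : 0 < l₂ := by linarith [h₂.1.1]
    set s : ℝ := l₂ / l₁ with hs
    have hs1 : 1 ≤ s := by rw [hs, le_div_iff₀ hl₁]; linarith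
    have hsz : s • (l₂⁻¹ • y) = l₁⁻¹ • y := by
      rw [smul_smul]
      congr 1
      rw [hs]
      field_simp
    have h1 := hRT _ h₂.2 s hs1 (by rw [hsz]; exact h₁.2)
    rw [hsz] at h1
    have hub := (hT _ h₁.2).2
    have hlb := (hT _ h₂.2).1
    have h2 : κ * a * (s - 1) < b - a := by linarith
    have h3 : s - 1 ≤ (b - a) / (κ * a) := by
      rw [le_div_iff₀ hκa]
      linarith [mul_comm (s - 1) (κ * a)]
    have h4 : l₁ * (s - 1) = l₂ - l₁ := by
      rw [hs]
      field_simp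
    have h5 : l₁ * (s - 1) ≤ 1 * (s - 1) :=
      mul_le_mul_of_nonneg_right h₁.1.2 (by linarith)
    linarith
  refine (Real.volume_le_diam W).trans (Metric.ediam_le ?_)
  intro l₁ h₁ l₂ h₂
  rw [edist_dist, Real.dist_eq]
  refine ENNReal.ofReal_le_ofReal ?_
  rcases le_total l₁ l₂ with h | h
  · rw [abs_sub_comm, abs_of_nonneg (by linarith)]
    exact key l₁ h₁ l₂ h₂ h
  · rw [abs_of_nonneg (by linarith)]
    exact key l₂ h₂ l₁ h₁ h

/-- **DILATION AVERAGING WITH A CUT AND AN ENVELOPE.**  `ν = e^{−A} dx` on `ℝ^ι`; `T = {a ≤ U < b} ∩ C` (the tested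
shell intersected with ANY measurable cut `C` — the other characteristic functions reading the block's variables);
`Env` measurable with `l • z ∈ Env` for `z ∈ T`, `l ∈ [1−τ, 1]` (the ENVELOPE of the inward dilates: `{U < b} ∩ C` when
every cut is star-shaped about the centre; larger otherwise — §X, Card 71); radial monotonicity of `A` on `T`; radial
transversality of `U` on `T` with constant `κ`.  Then `τ·ν(T) ≤ (1−τ)^{−d}·(b−a)/(κa)·ν(Env)`.  (G16's
`measure_shell_le_average` is the case `C = univ`, `Env = {(1−τ)a ≤ U < b}`, `κ = 1`, `U` 1-homogeneous.) [textbook] -/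
theorem measure_shellCut_le_average_env {A : (ι → ℝ) → ℝ} (hA : Measurable A) {U : (ι → ℝ) → ℝ}
    (hUm : Measurable U) {C Env : Set (ι → ℝ)} (hC : MeasurableSet C) (hEnv : MeasurableSet Env)
    {a b κ τ : ℝ} (ha : 0 < a) (hκ : 0 < κ) (hτ1 : τ < 1)
    (henv : ∀ l ∈ Icc (1 - τ) 1, ∀ z, a ≤ U z → U z < b → z ∈ C → l • z ∈ Env)
    (hmono : ∀ l ∈ Icc (1 - τ) 1, ∀ z, a ≤ U z → U z < b → z ∈ C → A (l • z) ≤ A z)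
    (hRT : ∀ z, a ≤ U z → U z < b → z ∈ C → ∀ s : ℝ, 1 ≤ s →
      a ≤ U (s • z) → U (s • z) < b → s • z ∈ C → U z + κ * a * (s - 1) ≤ U (s • z)) :
    ENNReal.ofReal τ *
        (volume.withDensity fun x => ENNReal.ofReal (Real.exp (-A x))) ({x | a ≤ U x ∧ U x < b} ∩ C)
      ≤ ENNReal.ofReal (((1 - τ) ^ Fintype.card ι)⁻¹ * ((b - a) / (κ * a)))
        * (volume.withDensity fun x => ENNReal.ofReal (Real.exp (-A x))) Env := by
  set g : (ι → ℝ) → ℝ≥0∞ := fun x => ENNReal.ofReal (Real.exp (-A x)) with hgdef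
  have hg : Measurable g := ENNReal.measurable_ofReal.comp (Real.measurable_exp.comp hA.neg)
  set T : Set (ι → ℝ) := {x | a ≤ U x ∧ U x < b} ∩ C with hTdef
  have hT : MeasurableSet T :=
    ((measurableSet_le measurable_const hUm).inter (measurableSet_lt hUm measurable_const)).inter hC
  have hTmem : ∀ z, z ∈ T ↔ (a ≤ U z ∧ U z < b) ∧ z ∈ C := fun z => Iff.rfl
  set d := Fintype.card ι with hd
  rw [withDensity_apply _ hT, withDensity_apply _ hEnv]
  -- (i) for every l ∈ [1−τ, 1]: ∫_T g ≤ (1−τ)^{-d} ∫ 𝟙[l•T] g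
  have hstep : ∀ l ∈ Icc (1 - τ) 1, ∫⁻ x in T, g x
      ≤ ENNReal.ofReal (((1 - τ) ^ d)⁻¹) * ∫⁻ y, (l • T).indicator g y := by
    intro l hl
    have hl0 : 0 < l := by linarith [hl.1]
    have h := setLIntegral_le_pow_mul_setLIntegral_smul hA hT hl0
      (fun x hx => hmono l hl x hx.1.1 hx.1.2 hx.2)
    rw [← lintegral_indicator (hT.const_smul₀ l)] at h
    refine h.trans (mul_le_mul_left (ENNReal.ofReal_le_ofReal ?_) _)
    rw [inv_le_inv₀ (pow_pos hl0 _) (pow_pos (by linarith) _)]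
    exact pow_le_pow_left₀ (by linarith) hl.1 _
  -- (ii) integrate over l
  have hI : ENNReal.ofReal τ * ∫⁻ x in T, g x
      = ∫⁻ _ in Icc (1 - τ) (1 : ℝ), ∫⁻ x in T, g x := by
    rw [setLIntegral_const, Real.volume_Icc, mul_comm]
    congr 2
    ring
  rw [hI]
  -- the jointly measurable integrand `F(l, y) = 𝟙[l⁻¹ • y ∈ T] g(y)`, equal to `𝟙[l•T] g` for `l ≠ 0`
  set F : ℝ × (ι → ℝ) → ℝ≥0∞ := {q : ℝ × (ι → ℝ) | q.1⁻¹ • q.2 ∈ T}.indicator (g ∘ Prod.snd) with hFdef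
  have hFset : MeasurableSet {q : ℝ × (ι → ℝ) | q.1⁻¹ • q.2 ∈ T} :=
    (measurable_fst.inv.smul measurable_snd) hT
  have hF : Measurable F := (hg.comp measurable_snd).indicator hFset
  have hFl : ∀ l ∈ Icc (1 - τ) (1 : ℝ), ∀ y, (l • T).indicator g y = F (l, y) := by
    intro l hl y
    have hl0 : l ≠ 0 := by linarith [hl.1]
    by_cases hy : l⁻¹ • y ∈ T
    · rw [indicator_of_mem ((Set.mem_smul_set_iff_inv_smul_mem₀ hl0 _ _).2 hy), hFdef,
        indicator_of_mem (show (l, y) ∈ {q : ℝ × (ι → ℝ) | q.1⁻¹ • q.2 ∈ T} from hy)]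
      rfl
    · rw [indicator_of_notMem (fun h => hy ((Set.mem_smul_set_iff_inv_smul_mem₀ hl0 _ _).1 h)), hFdef,
        indicator_of_notMem (show (l, y) ∉ {q : ℝ × (ι → ℝ) | q.1⁻¹ • q.2 ∈ T} from hy)]
  have hFunc : Measurable (Function.uncurry fun (l : ℝ) (y : ι → ℝ) => F (l, y)) := hF
  calc ∫⁻ l in Icc (1 - τ) (1 : ℝ), ∫⁻ x in T, g x
      ≤ ∫⁻ l in Icc (1 - τ) (1 : ℝ), ENNReal.ofReal (((1 - τ) ^ d)⁻¹) * ∫⁻ y, F (l, y) := by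
        refine setLIntegral_mono' measurableSet_Icc fun l hl => ?_
        have := hstep l hl
        simp_rw [hFl l hl] at this
        exact this
    _ = ENNReal.ofReal (((1 - τ) ^ d)⁻¹) * ∫⁻ l in Icc (1 - τ) (1 : ℝ), ∫⁻ y, F (l, y) := by
        rw [lintegral_const_mul' _ _ ENNReal.ofReal_ne_top]
    _ = ENNReal.ofReal (((1 - τ) ^ d)⁻¹) * ∫⁻ y, ∫⁻ l in Icc (1 - τ) (1 : ℝ), F (l, y) := by
        rw [lintegral_lintegral_swap hFunc.aemeasurable]
    _ ≤ ENNReal.ofReal (((1 - τ) ^ d)⁻¹) * ∫⁻ y, ENNReal.ofReal ((b - a) / (κ * a)) * Env.indicator g y := by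
        refine mul_le_mul_right (lintegral_mono fun y => ?_) _
        -- the inner integral is `g y ×` the length of the admissible parameters
        have hind : ∀ l, F (l, y) = {l : ℝ | l⁻¹ • y ∈ T}.indicator (fun _ => g y) l := by
          intro l
          by_cases h : l⁻¹ • y ∈ T
          · rw [hFdef, indicator_of_mem (show (l, y) ∈ {q : ℝ × (ι → ℝ) | q.1⁻¹ • q.2 ∈ T} from h),
              indicator_of_mem (show l ∈ {l : ℝ | l⁻¹ • y ∈ T} from h)]
            rfl
          · rw [hFdef, indicator_of_notMem (show (l, y) ∉ {q : ℝ × (ι → ℝ) | q.1⁻¹ • q.2 ∈ T} from h),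
              indicator_of_notMem (show l ∉ {l : ℝ | l⁻¹ • y ∈ T} from h)]
        have hlset : MeasurableSet {l : ℝ | l⁻¹ • y ∈ T} := (measurable_inv.smul_const y) hT
        simp_rw [hind]
        rw [lintegral_indicator hlset, setLIntegral_const, Measure.restrict_apply hlset]
        have hset_eq : {l : ℝ | l⁻¹ • y ∈ T} ∩ Icc (1 - τ) 1 = {l : ℝ | l ∈ Icc (1 - τ) 1 ∧ l⁻¹ • y ∈ T} := by
          ext l; simp only [mem_inter_iff, mem_setOf_eq]; tauto
        rw [hset_eq, mul_comm]
        by_cases hyE : y ∈ Env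
        · rw [indicator_of_mem hyE]
          refine mul_le_mul_left ?_ _
          refine volume_params_le_of_radialTransversal (T := T) ha hκ hτ1 (fun z hz => hz.1) ?_ y
          intro z hz s hs hsz
          exact hRT z hz.1.1 hz.1.2 hz.2 s hs hsz.1.1 hsz.1.2 hsz.2
        · -- no admissible parameter: any `l` with `l⁻¹ • y ∈ T` would put `y = l • (l⁻¹ • y)` in `Env`
          have hempty : {l : ℝ | l ∈ Icc (1 - τ) 1 ∧ l⁻¹ • y ∈ T} = ∅ := by
            ext l
            simp only [mem_setOf_eq, mem_empty_iff_false, iff_false, not_and]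
            intro hl hly
            apply hyE
            have hl0 : l ≠ 0 := by linarith [hl.1]
            have := henv l hl (l⁻¹ • y) hly.1.1 hly.1.2 hly.2
            rwa [smul_inv_smul₀ hl0] at this
          rw [hempty, measure_empty, zero_mul]
          exact bot_le
    _ = ENNReal.ofReal (((1 - τ) ^ d)⁻¹ * ((b - a) / (κ * a))) * ∫⁻ y in Env, g y := by
        rw [lintegral_const_mul _ (hg.indicator hEnv), lintegral_indicator hEnv, ← mul_assoc,
          ← ENNReal.ofReal_mul (inv_nonneg.2 (pow_nonneg (by linarith) _))]

/-- **THE SHELL ∩ CUT IS A `3(d+1)ρ∕(κ(1−ρ))`-FRACTION OF THE ENVELOPE MASS.**  `τ = 1∕(d+1)` in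
`measure_shellCut_le_average_env`: `ν({θ(1−ρ) ≤ U < θ} ∩ C) ≤ 3(d+1)·ρ∕(κ(1−ρ)) · ν(Env)`.  [textbook] -/
theorem measure_shellCut_le_of_radialTransversal [Nonempty ι] {A : (ι → ℝ) → ℝ} (hA : Measurable A)
    {U : (ι → ℝ) → ℝ} (hUm : Measurable U) {C Env : Set (ι → ℝ)} (hC : MeasurableSet C)
    (hEnv : MeasurableSet Env) {θ ρ κ : ℝ} (hθ : 0 < θ) (hρ0 : 0 < ρ) (hρ1 : ρ < 1) (hκ : 0 < κ)
    (henv : ∀ l ∈ Icc (1 - 1 / ((Fintype.card ι : ℝ) + 1)) 1, ∀ z,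
      θ * (1 - ρ) ≤ U z → U z < θ → z ∈ C → l • z ∈ Env)
    (hmono : ∀ l ∈ Icc (1 - 1 / ((Fintype.card ι : ℝ) + 1)) 1, ∀ z,
      θ * (1 - ρ) ≤ U z → U z < θ → z ∈ C → A (l • z) ≤ A z)
    (hRT : ∀ z, θ * (1 - ρ) ≤ U z → U z < θ → z ∈ C → ∀ s : ℝ, 1 ≤ s →
      θ * (1 - ρ) ≤ U (s • z) → U (s • z) < θ → s • z ∈ C →
        U z + κ * (θ * (1 - ρ)) * (s - 1) ≤ U (s • z)) :
    (volume.withDensity fun x => ENNReal.ofReal (Real.exp (-A x))) ({x | θ * (1 - ρ) ≤ U x ∧ U x < θ} ∩ C)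
      ≤ ENNReal.ofReal (3 * ((Fintype.card ι : ℝ) + 1) * (ρ / (κ * (1 - ρ))))
        * (volume.withDensity fun x => ENNReal.ofReal (Real.exp (-A x))) Env := by
  set d := Fintype.card ι with hd
  set τ : ℝ := 1 / ((d : ℝ) + 1) with hτ
  have hd1 : (0 : ℝ) < d + 1 := by positivity
  have hdge : (1 : ℝ) ≤ d := by
    rw [hd]
    exact_mod_cast Fintype.card_pos
  have hτ0 : 0 < τ := by positivity
  have hτ1 : τ < 1 := by
    rw [hτ, div_lt_one hd1]
    linarith
  have ha : 0 < θ * (1 - ρ) := mul_pos hθ (by linarith)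
  have h := measure_shellCut_le_average_env hA hUm hC hEnv ha hκ hτ1 henv hmono hRT
  have hτne : ENNReal.ofReal τ ≠ 0 := (ENNReal.ofReal_pos.2 hτ0).ne'
  have hτtop : ENNReal.ofReal τ ≠ ⊤ := ENNReal.ofReal_ne_top
  have hkey : (volume.withDensity fun x => ENNReal.ofReal (Real.exp (-A x)))
        ({x | θ * (1 - ρ) ≤ U x ∧ U x < θ} ∩ C)
      ≤ (ENNReal.ofReal τ)⁻¹ * (ENNReal.ofReal (((1 - τ) ^ d)⁻¹ * ((θ - θ * (1 - ρ)) / (κ * (θ * (1 - ρ)))))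
        * (volume.withDensity fun x => ENNReal.ofReal (Real.exp (-A x))) Env) := by
    rw [← ENNReal.mul_le_iff_le_inv hτne hτtop]
    exact h
  refine hkey.trans ?_
  rw [← mul_assoc, ← ENNReal.ofReal_inv_of_pos hτ0, ← ENNReal.ofReal_mul (inv_nonneg.2 hτ0.le)]
  refine mul_le_mul' (ENNReal.ofReal_le_ofReal ?_) le_rfl
  have hfrac : (θ - θ * (1 - ρ)) / (κ * (θ * (1 - ρ))) = ρ / (κ * (1 - ρ)) := by
    field_simp
    ring
  have hinv : τ⁻¹ = (d : ℝ) + 1 := by rw [hτ, one_div, inv_inv]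
  rw [hfrac, hinv]
  have h3 := inv_pow_le_three d
  have hρ' : 0 ≤ ρ / (κ * (1 - ρ)) := div_nonneg hρ0.le (mul_nonneg hκ.le (by linarith))
  calc ((d : ℝ) + 1) * (((1 - τ) ^ d)⁻¹ * (ρ / (κ * (1 - ρ))))
      ≤ ((d : ℝ) + 1) * (3 * (ρ / (κ * (1 - ρ)))) := by
        refine mul_le_mul_of_nonneg_left (mul_le_mul_of_nonneg_right ?_ hρ') hd1.le
        rw [hτ]; exact h3
    _ = 3 * ((d : ℝ) + 1) * (ρ / (κ * (1 - ρ))) := by ring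

omit [Fintype ι] in
/-- **ENVELOPE → SUPPORT: the excess is charged to ODDS.**  If `ν(Env ∖ P) ≤ Q · ν(P)` (`Q` = the
conditional odds, under the law `ν` restricted to the star-shaped cuts, that a DROPPED cut fails — a large-field
improbability of print's type, [LF-I] p. 176), then `ν(Env) ≤ (1 + Q)·ν(P)`. [textbook] -/
theorem measure_env_le_of_odds {Ω : Type*} [MeasurableSpace Ω] (ν : Measure Ω) (P Env : Set Ω)
    {Q : ℝ} (hQ0 : 0 ≤ Q) (hQ : ν (Env \ P) ≤ ENNReal.ofReal Q * ν P) :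
    ν Env ≤ ENNReal.ofReal (1 + Q) * ν P := by
  have h1 : Env ⊆ P ∪ (Env \ P) := by
    intro x hx
    by_cases hp : x ∈ P
    · exact Or.inl hp
    · exact Or.inr ⟨hx, hp⟩
  calc ν Env ≤ ν (P ∪ (Env \ P)) := measure_mono h1
    _ ≤ ν P + ν (Env \ P) := measure_union_le _ _
    _ ≤ ν P + ENNReal.ofReal Q * ν P := add_le_add le_rfl hQ
    _ = ENNReal.ofReal (1 + Q) * ν P := by
        rw [ENNReal.ofReal_add zero_le_one hQ0, ENNReal.ofReal_one, add_mul, one_mul]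

/-- **(M1) ON THE CUT LAW UNDER RADIAL TRANSVERSALITY, WITH DROPPED CUTS CHARGED TO ODDS.**  With the cut law
`μ = ν|({U < θ} ∩ C)`, the envelope hypotheses of `measure_shellCut_le_of_radialTransversal` and the odds bound
(envelope excess over the support) `ν(Env ∖ ({U<θ} ∩ C)) ≤ Q·ν({U<θ} ∩ C)`:
`SlotAntiConcentration μ U θ ρ (3(d+1)(1+Q)∕(κ(1−ρ)))`.  G16's `slotAntiConcentration_restrict_of_homogeneous` is
`C = univ`, `Env = {U<θ}`, `Q = 0`, `κ = 1`. [textbook] -/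
theorem slotAntiConcentration_restrict_of_radialTransversal [Nonempty ι] {A : (ι → ℝ) → ℝ} (hA : Measurable A)
    {U : (ι → ℝ) → ℝ} (hUm : Measurable U) {C Env : Set (ι → ℝ)} (hC : MeasurableSet C)
    (hEnv : MeasurableSet Env) {θ ρ κ Q : ℝ} (hθ : 0 < θ) (hρ0 : 0 < ρ) (hρ1 : ρ < 1) (hκ : 0 < κ) (hQ0 : 0 ≤ Q)
    (henv : ∀ l ∈ Icc (1 - 1 / ((Fintype.card ι : ℝ) + 1)) 1, ∀ z,
      θ * (1 - ρ) ≤ U z → U z < θ → z ∈ C → l • z ∈ Env)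
    (hmono : ∀ l ∈ Icc (1 - 1 / ((Fintype.card ι : ℝ) + 1)) 1, ∀ z,
      θ * (1 - ρ) ≤ U z → U z < θ → z ∈ C → A (l • z) ≤ A z)
    (hRT : ∀ z, θ * (1 - ρ) ≤ U z → U z < θ → z ∈ C → ∀ s : ℝ, 1 ≤ s →
      θ * (1 - ρ) ≤ U (s • z) → U (s • z) < θ → s • z ∈ C →
        U z + κ * (θ * (1 - ρ)) * (s - 1) ≤ U (s • z))
    (hQ : (volume.withDensity fun x => ENNReal.ofReal (Real.exp (-A x))) (Env \ ({x | U x < θ} ∩ C))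
      ≤ ENNReal.ofReal Q *
        (volume.withDensity fun x => ENNReal.ofReal (Real.exp (-A x))) ({x | U x < θ} ∩ C)) :
    SlotAntiConcentration
      ((volume.withDensity fun x => ENNReal.ofReal (Real.exp (-A x))).restrict ({x | U x < θ} ∩ C))
      U θ ρ (3 * ((Fintype.card ι : ℝ) + 1) * (1 + Q) / (κ * (1 - ρ))) := by
  unfold SlotAntiConcentration
  set ν := (volume.withDensity fun x : ι → ℝ => ENNReal.ofReal (Real.exp (-A x))) with hν
  have hE : MeasurableSet ({x : ι → ℝ | U x < θ} ∩ C) := (measurableSet_lt hUm measurable_const).inter hC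
  have hinter : {x : ι → ℝ | θ * (1 - ρ) ≤ U x ∧ U x < θ} ∩ ({x | U x < θ} ∩ C)
      = {x | θ * (1 - ρ) ≤ U x ∧ U x < θ} ∩ C := by
    ext x; simp only [mem_inter_iff, mem_setOf_eq]; tauto
  rw [Measure.restrict_apply_univ, Measure.restrict_apply' hE, hinter]
  have h1 := measure_shellCut_le_of_radialTransversal hA hUm hC hEnv hθ hρ0 hρ1 hκ henv hmono hRT
  have h2 := measure_env_le_of_odds ν _ _ hQ0 hQ
  refine h1.trans ((mul_le_mul_right h2 _).trans (le_of_eq ?_))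
  rw [← mul_assoc, ← ENNReal.ofReal_mul (by positivity [show (0:ℝ) < 1 - ρ by linarith])]
  congr 2
  field_simp

omit [Fintype ι] in
/-- **STAR-SHAPED CUTS RIDE ALONG; DROPPED CUTS DISAPPEAR FROM THE ENVELOPE.**  If `Cstar` is star-shaped about the
centre for the parameters in use and `U` does not exit its own cut under inward dilation, then for the cut
`C = Cstar ∩ Cdrop` (ANY `Cdrop`) the envelope `Env = {U < b} ∩ Cstar` qualifies. [textbook] -/
theorem smul_mem_env_of_star {U : (ι → ℝ) → ℝ} {Cstar Cdrop : Set (ι → ℝ)} {a b τ : ℝ}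
    (hstar : ∀ l ∈ Icc (1 - τ) 1, ∀ z ∈ Cstar, l • z ∈ Cstar)
    (hUexit : ∀ l ∈ Icc (1 - τ) 1, ∀ z, U z < b → U (l • z) < b) :
    ∀ l ∈ Icc (1 - τ) 1, ∀ z, a ≤ U z → U z < b → z ∈ Cstar ∩ Cdrop → l • z ∈ {x | U x < b} ∩ Cstar :=
  fun l hl z _ hzb hz => ⟨hUexit l hl z hzb, hstar l hl z hz.1⟩

/-! ## §K (this seat) Concordance test k3: part 16 is the instance `C = univ`, `Env = {U<θ}`, `κ = 1`, `Q = 0` -/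

/-- **CONCORDANCE (lens k3).**  Part 16's `slotAntiConcentration_restrict_of_homogeneous` re-derived from the lens's
`slotAntiConcentration_restrict_of_radialTransversal` at `C = univ`, `Env = {U < θ}`, `κ = 1`, `Q = 0`: an exactly
1-homogeneous statistic is radially transversal with `κ = 1` on its shell and never exits `{U < θ}` inward; the
envelope has no excess over the support.  Same constant `3(d+1)∕(1−ρ)`. [textbook] -/
theorem slotAntiConcentration_restrict_of_homogeneous_via_radialTransversal [Nonempty ι] {A : (ι → ℝ) → ℝ}
    (hA : Measurable A) {U : (ι → ℝ) → ℝ} (hUm : Measurable U)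
    (hU : ∀ (c : ℝ), 0 < c → ∀ x, U (c • x) = c * U x) {θ ρ : ℝ} (hθ : 0 < θ) (hρ0 : 0 < ρ) (hρ1 : ρ < 1)
    (hmono : ∀ l ∈ Icc (1 - 1 / ((Fintype.card ι : ℝ) + 1)) 1, ∀ x,
      θ * (1 - ρ) ≤ U x → U x < θ → A (l • x) ≤ A x) :
    SlotAntiConcentration
      ((volume.withDensity fun x => ENNReal.ofReal (Real.exp (-A x))).restrict ({x | U x < θ} ∩ univ))
      U θ ρ (3 * ((Fintype.card ι : ℝ) + 1) * (1 + 0) / (1 * (1 - ρ))) := by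
  have hd1 : (0 : ℝ) < (Fintype.card ι : ℝ) + 1 := by positivity
  have ha : 0 < θ * (1 - ρ) := mul_pos hθ (by linarith)
  refine slotAntiConcentration_restrict_of_radialTransversal (C := univ) (Env := {x | U x < θ}) hA hUm
    MeasurableSet.univ (measurableSet_lt hUm measurable_const) hθ hρ0 hρ1 one_pos le_rfl ?_
    (fun l hl z h1 h2 _ => hmono l hl z h1 h2) ?_ ?_
  · -- envelope: `U(l•z) = l·U z < θ` for `l ≤ 1`, `0 ≤ U z < θ`
    intro l hl z h1 h2 _
    have hl0 : 0 < l := by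
      have hcard : (1 : ℝ) ≤ (Fintype.card ι : ℝ) := by exact_mod_cast Fintype.card_pos
      have : 1 / ((Fintype.card ι : ℝ) + 1) < 1 := by
        rw [div_lt_one hd1]
        linarith
      linarith [hl.1]
    show U (l • z) < θ
    rw [hU l hl0 z]
    have hUz : 0 ≤ U z := le_trans ha.le h1
    calc l * U z ≤ 1 * U z := mul_le_mul_of_nonneg_right hl.2 hUz
      _ = U z := one_mul _
      _ < θ := h2
  · -- radial transversality with `κ = 1`: `U(s•z) − U z = (s−1)·U z ≥ (s−1)·a`
    intro z h1 _ _ s hs _ _ _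
    rw [hU s (by linarith) z]
    nlinarith
  · -- no excess: `Env ∖ support = ∅`
    rw [Set.inter_univ, Set.sdiff_self, measure_empty]
    exact bot_le

/-! ## §E (this seat, lens ROW G) The END with a multiplicative constant: `M·3(d_j+1)∕(1−ρ_j)`, `M = (1+Q)∕κ` -/

section End

open Literature.MathematicalPhysics.QuantumFieldTheory.Balaban1983to89 T4IndicatorShell T4ShellMeasureLevels
open Summit.QuantumFields.YangMills.Theorems.N21LevelLedgerLinearGrowth (shellWeightBound_of_levels_summable)
open Summit.QuantumFields.YangMills.Theorems.N21DilationRoadEnd (summable_dilationConst_mul)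

variable {κ' σ σ' : Type*} {l₀ : ℝ} {T : ℕ → Finset κ'} {Aw Bw shA shB : ℕ → ℝ → κ' → ℝ}
  {SA : ℕ → Finset σ} {SB : ℕ → Finset σ'} {pieceA : ℕ → ℝ → σ → κ' → ℝ} {pieceB : ℕ → ℝ → σ' → κ' → ℝ}
  {lvlA : ℕ → σ → ℕ} {lvlB : ℕ → σ' → ℕ} {dA ρA dB ρB : ℕ → ℝ} {N₁ : ℕ} {νbar d₀ c₁ ϑ M : ℝ} {p : ℕ}

/-- **NE7c FROM THE TRANSVERSAL DILATION ROAD (at the END, by name; lens ROW G).**  As part 17's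
`shellWeightBound_of_levels_dilation` with the level constants multiplied by a level-independent `M ≥ 0` (the road's
`(1+Q₀)∕κ₀`): no new summability lemma — `Summable.mul_left`. [folklore] -/
theorem shellWeightBound_of_levels_dilation_const
    (hA : LevelLedger l₀ T Aw shA SA pieceA lvlA (fun j => M * (3 * (dA j + 1) / (1 - ρA j))) ρA)
    (hB : LevelLedger l₀ T Bw shB SB pieceB lvlB (fun j => M * (3 * (dB j + 1) / (1 - ρB j))) ρB)
    (hwA : LiveWindow SA lvlA N₁ νbar) (hwB : LiveWindow SB lvlB N₁ νbar)
    (hϑ0 : 0 ≤ ϑ) (hϑ1 : ϑ < 1)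
    (hdA0 : ∀ j, 0 ≤ dA j) (hdA : ∀ j, dA j ≤ d₀ * ((j : ℝ) ^ p + 1))
    (hdB0 : ∀ j, 0 ≤ dB j) (hdB : ∀ j, dB j ≤ d₀ * ((j : ℝ) ^ p + 1))
    (hρAhalf : ∀ j, ρA j ≤ 1 / 2) (hρA : ∀ j, ρA j ≤ c₁ * ϑ ^ j)
    (hρBhalf : ∀ j, ρB j ≤ 1 / 2) (hρB : ∀ j, ρB j ≤ c₁ * ϑ ^ j) :
    ShellWeightBound l₀ T Aw Bw shA shB (fun K => hA.toSlotLedger.omega K + hB.toSlotLedger.omega K) := by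
  have hsA : Summable (fun j => (M * (3 * (dA j + 1) / (1 - ρA j))) * ρA j) := by
    have h := (summable_dilationConst_mul hϑ0 hϑ1 hdA0 hdA hA.ρ_nonneg hρAhalf hρA).mul_left M
    refine h.congr fun j => ?_
    ring
  have hsB : Summable (fun j => (M * (3 * (dB j + 1) / (1 - ρB j))) * ρB j) := by
    have h := (summable_dilationConst_mul hϑ0 hϑ1 hdB0 hdB hB.ρ_nonneg hρBhalf hρB).mul_left M
    refine h.congr fun j => ?_
    ring
  exact shellWeightBound_of_levels_summable hA hB hwA hwB hsA hsB

end End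

end Summit.QuantumFields.YangMills.Theorems.N21DilationTransversal
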